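import Mathlib
import HarnessLib
import Summits.ValiantsHypothesis.ValiantsHypothesis.Theorems.LacunarySymmetroidMatrixDescartesProductPlusOneSlopeConvexity
import Summits.ValiantsHypothesis.ValiantsHypothesis.Theorems.LacunarySymmetroidMatrixDescartesProductPlusOneChartForms
import Summits.ValiantsHypothesis.ValiantsHypothesis.Theorems.LacunarySymmetroidMatrixDescartesProductPlusOneOneRiser
import Summits.ValiantsHypothesis.ValiantsHypothesis.Theorems.LacunarySymmetroidMatrixDescartesProductPlusOneCrossingInterlace

/-!
# LINE (A) `product_plus_one` — the first interaction cell carries AT MOST TWO zeros of the company's log-Wronskian (LINE currency, K = 3),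
# hence at most three zeros of `eulerNumerator d a l₀` for EVERY coupling `l₀`

Line-currency wrapper of ✓/⧗ `…ProductPlusOneSlopeConvexity` (`oneRiser_slope_no_three_zeros`) for the W-budget frame EB2-W of val-idea-25 g3
(memo §14: `Z₊(eulerNumerator d a l₀) ≤ Z₊(W(P)) + 2m + 1`, `W(P) = P·θ²P − (θP)²`, `P = ∏_j fewnomial d (a j)`).

* `logWronskian_row_eq_rowPsi1` — for a `K = 3` row `f = Σ_l C a_l X^{d_l}` (`d 1 = d 0 + e₁ + 1`, `d 2 = d 1 + e₂ + 1`) and `x > 0` off its zero: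
  `W(f)(x) = −f(x)²·rowPsi1 e₁ e₂ a₀ (−a₁) (−a₂) x` (the row's slope `θφ` in the normal form of ✓ `…CloudDefs`, either branch);
* `logWronskian_prod_eq_rowPsi1_sum` — `W(P)(x) = −P(x)²·Σ_j rowPsi1 e₁ e₂ a_{j0} (−a_{j1}) (−a_{j2}) x` (✓ `theta_wronskian_prod`);
* ★★ `oneRiser_trinomialCloud_wronskian_no_three_zeros` — support `d 0 < d 1 < d 2`; riser row `j₀` with `a_{j₀0} ≥ 0`, `a_{j₀1} < 0`, `a_{j₀2} < 0`;
  every other row an incoherent puller (`a_{j0} > 0`, `a_{j1} ≤ 0`, `a_{j2} ≤ 0`, `a_{j1} + a_{j2} < 0`); on `[x₁, x₃] ⊂ (0,∞)` with the riser switched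
  (`f_{j₀} < 0`) and the pullers unswitched at `x₃`: `W(∏_j f_j)` does not vanish at three points `x₁ < x₂ < x₃` — the ρ_I = 1 cell (first gap of
  every T5-all member, in any binomial/trinomial incoherent company) carries ≤ 2 zeros of the log-Wronskian: NO W-wiggle beyond the one rise;
* ★ `oneRiser_trinomialCloud_wronskian_roots_le_two` / ★★ `oneRiser_trinomialCloud_eulerNumerator_roots_le_three` — the counts: on such a window
  `#{zeros of W(P)} ≤ 2` and, for EVERY coupling `l₀`, `#{zeros of eulerNumerator d a l₀} ≤ 3` (✓ `eulerNumerator_roots_Icc_le_wronskian_roots_add_one`;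
  ✓ `…CloudLine` was the bottom coupling `l₀ = 0` only).

Contrast (owner's certified E(n) family, 02:15Z): with ONE-SIGNED rows in the company `W(P)` carries `2` extra zeros per knee; here the company is
incoherent and the cell is wiggle-free.  HONEST FRAMING: one cell; several switched rows / one-signed or coherent company / the budget law
`WronskianBudgetK3` / `OneChangeFloorK3` / the stubs / `MatrixDescartes` OPEN; `VP ≠ VNP` NOT proved.  No definitions, no named facts.
-/

set_option linter.dupNamespace false

namespace Summit.ValiantsHypothesis.ValiantsHypothesis.Theorems.LacunarySymmetroidMatrixDescartes

namespace ProductPlusOne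

open Finset Polynomial
open scoped BigOperators Polynomial

/-! ### §1 The log-Wronskian of a K = 3 row and of the company through `rowPsi1` -/

/-- **One row:** `W(f)(x) = −f(x)²·rowPsi1 e₁ e₂ a₀ (−a₁) (−a₂) x` for `f = Σ_l C a_l X^{d_l}`, `x > 0`, `f(x) ≠ 0`. [this file's lemma] -/
theorem logWronskian_row_eq_rowPsi1 (d : Fin 3 → ℕ) (e₁ e₂ : ℕ) (he₁ : d 1 = d 0 + e₁ + 1) (he₂ : d 2 = d 1 + e₂ + 1)
    (b : Fin 3 → ℝ) {x : ℝ} (hx : 0 < x) (hF : (∑ l, C (b l) * X ^ (d l) : ℝ[X]).eval x ≠ 0) :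
    ((∑ l, C (b l) * X ^ (d l) : ℝ[X]) * (X * derivative (X * derivative (∑ l, C (b l) * X ^ (d l) : ℝ[X])))
        - (X * derivative (∑ l, C (b l) * X ^ (d l) : ℝ[X])) ^ 2).eval x
      = -((∑ l, C (b l) * X ^ (d l) : ℝ[X]).eval x) ^ 2 * rowPsi1 e₁ e₂ (b 0) (-(b 1)) (-(b 2)) x := by
  have hd := fin3_support_eq_gaps d e₁ e₂ he₁ he₂
  have hev : (∑ l, C (b l) * X ^ (d l) : ℝ[X]).eval x
      = b 0 * x ^ (d 0) + b 1 * x ^ (d 0 + (e₁ + 1)) + b 2 * x ^ (d 0 + (e₁ + e₂ + 2)) := by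
    have h := (eval_trinomial_three (d 0) (e₁ + 1) (e₁ + e₂ + 2) b x).1
    rw [hd] at h; exact h
  -- the stripped row does not vanish
  have hg : b 0 + b 1 * x ^ (e₁ + 1) + b 2 * x ^ (e₁ + e₂ + 2) ≠ 0 := by
    intro h0
    apply hF
    rw [hev]
    have : b 0 * x ^ (d 0) + b 1 * x ^ (d 0 + (e₁ + 1)) + b 2 * x ^ (d 0 + (e₁ + e₂ + 2))
        = x ^ (d 0) * (b 0 + b 1 * x ^ (e₁ + 1) + b 2 * x ^ (e₁ + e₂ + 2)) := by ring
    rw [this, h0, mul_zero]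
  rw [eval_logWronskian_fewnomial_eq d b x]
  have hshift := wronskianForm_shift_level (fun l => (d l : ℝ)) (fun l => b l * x ^ (d l)) (d 0 : ℝ) 0
  simp only [zero_mul, sub_zero] at hshift
  rw [hshift, hev]
  simp only [Fin.sum_univ_three, sub_self, zero_mul, zero_add]
  have e1 : ((d 1 : ℕ) : ℝ) - d 0 = (e₁ : ℝ) + 1 := by rw [he₁]; push_cast; ring
  have e2 : ((d 2 : ℕ) : ℝ) - d 0 = (e₁ : ℝ) + e₂ + 2 := by rw [he₂, he₁]; push_cast; ring
  have p1 : x ^ (d 1) = x ^ (d 0) * x ^ (e₁ + 1) := by rw [he₁, add_assoc, pow_add]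
  have p2 : x ^ (d 2) = x ^ (d 0) * x ^ (e₁ + e₂ + 2) := by
    have : d 2 = d 0 + (e₁ + e₂ + 2) := by omega
    rw [this, pow_add]
  rw [e1, e2, p1, p2]
  unfold rowPsi1 rowH rowU
  have e : b 0 - -b 1 * x ^ (e₁ + 1) - -b 2 * x ^ (e₁ + e₂ + 2) = b 0 + b 1 * x ^ (e₁ + 1) + b 2 * x ^ (e₁ + e₂ + 2) := by ring
  rw [e, pow_one]
  have hxd : x ^ (d 0) ≠ 0 := pow_ne_zero _ hx.ne'
  field_simp
  ring

/-- **The company:** `W(∏_j f_j)(x) = −(∏_j f_j(x))²·Σ_j rowPsi1 e₁ e₂ a_{j0} (−a_{j1}) (−a_{j2}) x` (`x > 0`, no row vanishing at `x`). [this file's lemma] -/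
theorem logWronskian_prod_eq_rowPsi1_sum {m : ℕ} (d : Fin 3 → ℕ) (e₁ e₂ : ℕ) (he₁ : d 1 = d 0 + e₁ + 1) (he₂ : d 2 = d 1 + e₂ + 1)
    (a : Fin m → Fin 3 → ℝ) {x : ℝ} (hx : 0 < x) (hf : ∀ j, (∑ l, C (a j l) * X ^ (d l) : ℝ[X]).eval x ≠ 0) :
    ((∏ j, ∑ l, C (a j l) * X ^ (d l) : ℝ[X]) * (X * derivative (X * derivative (∏ j, ∑ l, C (a j l) * X ^ (d l) : ℝ[X])))
        - (X * derivative (∏ j, ∑ l, C (a j l) * X ^ (d l) : ℝ[X])) ^ 2).eval x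
      = -((∏ j, (∑ l, C (a j l) * X ^ (d l) : ℝ[X])).eval x) ^ 2
          * ∑ j, rowPsi1 e₁ e₂ (a j 0) (-(a j 1)) (-(a j 2)) x := by
  classical
  have hW := congrArg (Polynomial.eval x) (theta_wronskian_prod (fun j => (∑ l, C (a j l) * X ^ (d l) : ℝ[X])))
  rw [eval_finsetSum] at hW
  rw [hW, eval_prod, Finset.mul_sum]
  refine Finset.sum_congr rfl fun j _ => ?_
  rw [eval_mul, logWronskian_row_eq_rowPsi1 d e₁ e₂ he₁ he₂ (a j) hx (hf j), eval_prod]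
  simp only [eval_pow]
  rw [← Finset.mul_prod_erase Finset.univ (fun i => (∑ l, C (a i l) * X ^ (d l) : ℝ[X]).eval x) (Finset.mem_univ j),
    mul_pow, ← Finset.prod_pow]
  ring

/-- **W-hull:** at a point `x > 0` off the poles where EVERY row's slope form `rowPsi1 e₁ e₂ a_{j0} (−a_{j1}) (−a_{j2}) x` is `≥ 0` and one is
`> 0` (e.g. every incoherent row unswitched or switched before its turning point), `W(∏ f_j)(x) < 0`; in particular the company's log-Wronskian
has no zero there (the W-analogue of ✓ `eulerNumerator_eval_ne_zero_of_all_unswitched`). [this file's lemma] -/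
theorem logWronskian_prod_neg_of_slopes_nonneg {m : ℕ} (d : Fin 3 → ℕ) (e₁ e₂ : ℕ) (he₁ : d 1 = d 0 + e₁ + 1) (he₂ : d 2 = d 1 + e₂ + 1)
    (a : Fin m → Fin 3 → ℝ) {x : ℝ} (hx : 0 < x) (hf : ∀ j, (∑ l, C (a j l) * X ^ (d l) : ℝ[X]).eval x ≠ 0)
    (hge : ∀ j, 0 ≤ rowPsi1 e₁ e₂ (a j 0) (-(a j 1)) (-(a j 2)) x) (hpos : ∃ j, 0 < rowPsi1 e₁ e₂ (a j 0) (-(a j 1)) (-(a j 2)) x) :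
    ((∏ j, ∑ l, C (a j l) * X ^ (d l) : ℝ[X]) * (X * derivative (X * derivative (∏ j, ∑ l, C (a j l) * X ^ (d l) : ℝ[X])))
        - (X * derivative (∏ j, ∑ l, C (a j l) * X ^ (d l) : ℝ[X])) ^ 2).eval x < 0 := by
  classical
  rw [logWronskian_prod_eq_rowPsi1_sum d e₁ e₂ he₁ he₂ a hx hf]
  have hP : 0 < ((∏ j, (∑ l, C (a j l) * X ^ (d l) : ℝ[X])).eval x) ^ 2 := by
    rw [eval_prod]; exact sq_pos_iff.mpr (Finset.prod_ne_zero_iff.2 fun j _ => hf j)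
  obtain ⟨j₀, hj₀⟩ := hpos
  have hS : 0 < ∑ j, rowPsi1 e₁ e₂ (a j 0) (-(a j 1)) (-(a j 2)) x :=
    Finset.sum_pos' (fun j _ => hge j) ⟨j₀, Finset.mem_univ _, hj₀⟩
  nlinarith

/-! ### §2 The cell in W-currency -/

/-- ★★ **ONE SWITCHED INCOHERENT RISER AGAINST ANY INCOHERENT CLOUD: the company's log-Wronskian has NO THREE ZEROS on the window** (LINE currency,
K = 3).  Support `d 0 < d 1 < d 2`; riser row `j₀` with `a_{j₀0} ≥ 0`, `a_{j₀1} < 0`, `a_{j₀2} < 0`; every other row an incoherent puller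
(`a_{j0} > 0`, `a_{j1} ≤ 0`, `a_{j2} ≤ 0`, `a_{j1} + a_{j2} < 0`).  On `[x₁, x₃] ⊂ (0,∞)` where the riser is switched (`f_{j₀} < 0`) and every puller
unswitched at `x₃`, `W(∏_j f_j) = P·θ²P − (θP)²` does not vanish at three points `x₁ < x₂ < x₃`. [this file's theorem] -/
theorem oneRiser_trinomialCloud_wronskian_no_three_zeros {m : ℕ} (d : Fin 3 → ℕ) (h01 : d 0 < d 1) (h12 : d 1 < d 2)
    (a : Fin m → Fin 3 → ℝ) (j₀ : Fin m) (hr0 : 0 ≤ a j₀ 0) (hr1 : a j₀ 1 < 0) (hr2 : a j₀ 2 < 0)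
    (hpul : ∀ j, j ≠ j₀ → 0 < a j 0 ∧ a j 1 ≤ 0 ∧ a j 2 ≤ 0 ∧ a j 1 + a j 2 < 0)
    {x₁ x₂ x₃ : ℝ} (h0 : 0 < x₁) (h12' : x₁ < x₂) (h23 : x₂ < x₃)
    (hsw : ∀ x ∈ Set.Icc x₁ x₃, (∑ l, C (a j₀ l) * X ^ (d l) : ℝ[X]).eval x < 0)
    (hun : ∀ j, j ≠ j₀ → 0 < (∑ l, C (a j l) * X ^ (d l) : ℝ[X]).eval x₃)
    (hzero : ∀ x ∈ ({x₁, x₂, x₃} : Set ℝ),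
      ((∏ j, ∑ l, C (a j l) * X ^ (d l) : ℝ[X]) * (X * derivative (X * derivative (∏ j, ∑ l, C (a j l) * X ^ (d l) : ℝ[X])))
        - (X * derivative (∏ j, ∑ l, C (a j l) * X ^ (d l) : ℝ[X])) ^ 2).eval x = 0) : False := by
  classical
  obtain ⟨e₁, he₁⟩ := Nat.exists_eq_add_of_lt h01
  obtain ⟨e₂, he₂⟩ := Nat.exists_eq_add_of_lt h12
  have hd := fin3_support_eq_gaps d e₁ e₂ he₁ he₂
  have hev : ∀ j x, (∑ l, C (a j l) * X ^ (d l) : ℝ[X]).eval x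
        = a j 0 * x ^ (d 0) + a j 1 * x ^ (d 0 + (e₁ + 1)) + a j 2 * x ^ (d 0 + (e₁ + e₂ + 2)) := by
    intro j x
    have h := (eval_trinomial_three (d 0) (e₁ + 1) (e₁ + e₂ + 2) (a j) x).1
    rw [hd] at h
    exact h
  have h13 : x₁ < x₃ := h12'.trans h23
  have hIcc : ∀ x ∈ ({x₁, x₂, x₃} : Set ℝ), x ∈ Set.Icc x₁ x₃ := by
    intro x hx
    simp only [Set.mem_insert_iff, Set.mem_singleton_iff] at hx
    rcases hx with h | h | h <;> (subst h; constructor <;> linarith)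
  -- riser switched on the interval (normal form)
  have hsw' : ∀ x ∈ Set.Icc x₁ x₃, a j₀ 0 - (-(a j₀ 1)) * x ^ (e₁ + 1) - (-(a j₀ 2)) * x ^ (e₁ + e₂ + 2) < 0 := by
    intro x hx
    have hx0 : 0 < x := h0.trans_le hx.1
    have h := hsw x hx
    rw [hev] at h
    have hfac : a j₀ 0 * x ^ (d 0) + a j₀ 1 * x ^ (d 0 + (e₁ + 1)) + a j₀ 2 * x ^ (d 0 + (e₁ + e₂ + 2))
        = x ^ (d 0) * (a j₀ 0 - (-(a j₀ 1)) * x ^ (e₁ + 1) - (-(a j₀ 2)) * x ^ (e₁ + e₂ + 2)) := by ring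
    rw [hfac] at h
    have hxd : 0 < x ^ (d 0) := pow_pos hx0 _
    exact ((mul_neg_iff.1 h).resolve_right (fun h' => absurd hxd (not_lt.2 h'.1.le))).2
  -- pullers unswitched on the whole interval (their normal form is antitone in `x`)
  have hp' : ∀ x ∈ Set.Icc x₁ x₃, ∀ j, j ≠ j₀ →
      0 < a j 0 - (-(a j 1)) * x ^ (e₁ + 1) - (-(a j 2)) * x ^ (e₁ + e₂ + 2) := by
    intro x hx j hj
    have hx0 : 0 < x := h0.trans_le hx.1
    obtain ⟨_, h1, h2, _⟩ := hpul j hj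
    have h := hun j hj
    rw [hev] at h
    have hfac : a j 0 * x₃ ^ (d 0) + a j 1 * x₃ ^ (d 0 + (e₁ + 1)) + a j 2 * x₃ ^ (d 0 + (e₁ + e₂ + 2))
        = x₃ ^ (d 0) * (a j 0 + a j 1 * x₃ ^ (e₁ + 1) + a j 2 * x₃ ^ (e₁ + e₂ + 2)) := by ring
    rw [hfac] at h
    have hx3 : 0 < x₃ ^ (d 0) := pow_pos (h0.trans h13) _
    have h3 : 0 < a j 0 + a j 1 * x₃ ^ (e₁ + 1) + a j 2 * x₃ ^ (e₁ + e₂ + 2) := (mul_pos_iff_of_pos_left hx3).1 h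
    have hm1 : a j 1 * x₃ ^ (e₁ + 1) ≤ a j 1 * x ^ (e₁ + 1) :=
      mul_le_mul_of_nonpos_left (pow_le_pow_left₀ hx0.le hx.2 _) h1
    have hm2 : a j 2 * x₃ ^ (e₁ + e₂ + 2) ≤ a j 2 * x ^ (e₁ + e₂ + 2) :=
      mul_le_mul_of_nonpos_left (pow_le_pow_left₀ hx0.le hx.2 _) h2
    linarith
  -- no row vanishes on the interval
  have hf : ∀ x ∈ Set.Icc x₁ x₃, ∀ j, (∑ l, C (a j l) * X ^ (d l) : ℝ[X]).eval x ≠ 0 := by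
    intro x hx j
    by_cases hj : j = j₀
    · subst hj; exact (hsw x hx).ne
    · have hx0 : 0 < x := h0.trans_le hx.1
      rw [hev]
      have hfac : a j 0 * x ^ (d 0) + a j 1 * x ^ (d 0 + (e₁ + 1)) + a j 2 * x ^ (d 0 + (e₁ + e₂ + 2))
          = x ^ (d 0) * (a j 0 - (-(a j 1)) * x ^ (e₁ + 1) - (-(a j 2)) * x ^ (e₁ + e₂ + 2)) := by ring
      rw [hfac]
      exact mul_ne_zero (pow_ne_zero _ hx0.ne') (hp' x hx j hj).ne'
  -- the sum of the slopes vanishes at the three points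
  have hzero' : ∀ x ∈ ({x₁, x₂, x₃} : Set ℝ),
      rowPsi1 e₁ e₂ (a j₀ 0) (-(a j₀ 1)) (-(a j₀ 2)) x
        + cloudP1 e₁ e₂ (Finset.univ.erase j₀) (fun _ => (1 : ℝ)) (fun j => a j 0) (fun j => -(a j 1)) (fun j => -(a j 2)) x = 0 := by
    intro x hx
    have hxI := hIcc x hx
    have hx0 : 0 < x := h0.trans_le hxI.1
    have h := hzero x hx
    rw [logWronskian_prod_eq_rowPsi1_sum d e₁ e₂ he₁ he₂ a hx0 (hf x hxI)] at h
    have hP : ((∏ j, (∑ l, C (a j l) * X ^ (d l) : ℝ[X])).eval x) ≠ 0 := by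
      rw [eval_prod]; exact Finset.prod_ne_zero_iff.2 fun j _ => hf x hxI j
    have hS : ∑ j, rowPsi1 e₁ e₂ (a j 0) (-(a j 1)) (-(a j 2)) x = 0 := by
      rcases mul_eq_zero.1 h with h1 | h1
      · exact absurd (neg_eq_zero.1 h1) (pow_ne_zero 2 hP)
      · exact h1
    rw [← Finset.add_sum_erase _ _ (Finset.mem_univ j₀)] at hS
    unfold cloudP1
    simpa only [one_mul] using hS
  -- with or without pullers
  rcases (Finset.univ.erase j₀).eq_empty_or_nonempty with hs | hs
  · have h1 := hzero' x₁ (by simp)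
    have h2 := hzero' x₂ (by simp)
    rw [hs] at h1 h2
    simp only [cloudP1, Finset.sum_empty, add_zero] at h1 h2
    have hper := riser_turning_persist e₁ e₂ (a j₀ 0) (-(a j₀ 1)) (-(a j₀ 2)) (by linarith) (by linarith) h0 h13.le hsw'
      h1.le x₂ ⟨h12', h23.le⟩
    exact absurd h2 hper.ne
  · exact oneRiser_slope_no_three_zeros e₁ e₂ (a := a j₀ 0) (b := -(a j₀ 1)) (c := -(a j₀ 2)) hr0 (by linarith) (by linarith)
      (Finset.univ.erase j₀) hs (fun _ => (1 : ℝ)) (fun j => a j 0) (fun j => -(a j 1)) (fun j => -(a j 2))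
      (fun _ _ => one_pos) (fun j hj => by have := (hpul j (Finset.ne_of_mem_erase hj)).2.1; linarith)
      (fun j hj => by have := (hpul j (Finset.ne_of_mem_erase hj)).2.2.1; linarith)
      (fun j hj => by have := (hpul j (Finset.ne_of_mem_erase hj)).2.2.2; linarith)
      h0 h12' h23 hsw' (fun x hx j hj => hp' x hx j (Finset.ne_of_mem_erase hj)) hzero'

/-! ### §3 The counts: ≤ 2 zeros of `W(P)`, ≤ 3 zeros of `eulerNumerator d a l₀` for every coupling -/

/-- A finite set of reals with at least three elements contains `y₁ < y₂ < y₃`. [folklore] -/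
theorem exists_three_lt_of_card {T : Finset ℝ} (h : 3 ≤ T.card) : ∃ y₁ ∈ T, ∃ y₂ ∈ T, ∃ y₃ ∈ T, y₁ < y₂ ∧ y₂ < y₃ := by
  have hT : T.Nonempty := Finset.card_pos.1 (by omega)
  set y₁ := T.min' hT with hy₁
  have hT2 : (T.erase y₁).Nonempty := Finset.card_pos.1 (by rw [Finset.card_erase_of_mem (T.min'_mem hT)]; omega)
  set y₂ := (T.erase y₁).min' hT2 with hy₂
  have hT3 : ((T.erase y₁).erase y₂).Nonempty :=
    Finset.card_pos.1 (by rw [Finset.card_erase_of_mem ((T.erase y₁).min'_mem hT2), Finset.card_erase_of_mem (T.min'_mem hT)]; omega)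
  obtain ⟨y₃, hy₃⟩ := hT3
  have hy₂mem : y₂ ∈ T.erase y₁ := (T.erase y₁).min'_mem hT2
  have hy₃mem2 : y₃ ∈ T.erase y₁ := Finset.mem_of_mem_erase hy₃
  refine ⟨y₁, T.min'_mem hT, y₂, Finset.mem_of_mem_erase hy₂mem, y₃, Finset.mem_of_mem_erase hy₃mem2, ?_, ?_⟩
  · exact lt_of_le_of_ne (T.min'_le _ (Finset.mem_of_mem_erase hy₂mem)) (Finset.ne_of_mem_erase hy₂mem).symm
  · exact lt_of_le_of_ne ((T.erase y₁).min'_le _ hy₃mem2) (Finset.ne_of_mem_erase hy₃).symm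

/-- ★ **The ρ_I = 1 cell carries at most TWO zeros of the company's log-Wronskian** (same hypotheses on a pole-free window `[u, v] ⊂ (0,∞)`:
riser switched on `[u,v]`, pullers unswitched at `v`). [this file's theorem] -/
theorem oneRiser_trinomialCloud_wronskian_roots_le_two {m : ℕ} (d : Fin 3 → ℕ) (h01 : d 0 < d 1) (h12 : d 1 < d 2)
    (a : Fin m → Fin 3 → ℝ) (j₀ : Fin m) (hr0 : 0 ≤ a j₀ 0) (hr1 : a j₀ 1 < 0) (hr2 : a j₀ 2 < 0)
    (hpul : ∀ j, j ≠ j₀ → 0 < a j 0 ∧ a j 1 ≤ 0 ∧ a j 2 ≤ 0 ∧ a j 1 + a j 2 < 0)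
    {u v : ℝ} (hu : 0 < u)
    (hsw : ∀ x ∈ Set.Icc u v, (∑ l, C (a j₀ l) * X ^ (d l) : ℝ[X]).eval x < 0)
    (hun : ∀ j, j ≠ j₀ → 0 < (∑ l, C (a j l) * X ^ (d l) : ℝ[X]).eval v) :
    (((∏ j, ∑ l, C (a j l) * X ^ (d l) : ℝ[X]) * (X * derivative (X * derivative (∏ j, ∑ l, C (a j l) * X ^ (d l) : ℝ[X])))
        - (X * derivative (∏ j, ∑ l, C (a j l) * X ^ (d l) : ℝ[X])) ^ 2).roots.toFinset.filter (fun w => u < w ∧ w < v)).card ≤ 2 := by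
  classical
  set W : ℝ[X] := (∏ j, ∑ l, C (a j l) * X ^ (d l) : ℝ[X]) * (X * derivative (X * derivative (∏ j, ∑ l, C (a j l) * X ^ (d l) : ℝ[X])))
      - (X * derivative (∏ j, ∑ l, C (a j l) * X ^ (d l) : ℝ[X])) ^ 2 with hWdef
  by_contra hgt
  push Not at hgt
  obtain ⟨y₁, hy₁, y₂, hy₂, y₃, hy₃, h12', h23⟩ := exists_three_lt_of_card (T := W.roots.toFinset.filter (fun w => u < w ∧ w < v)) hgt
  by_cases hW0 : W = 0
  · rw [hW0, roots_zero, Multiset.toFinset_zero, Finset.filter_empty] at hy₁; exact absurd hy₁ (Finset.notMem_empty _)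
  rw [mem_filter, Multiset.mem_toFinset, mem_roots hW0] at hy₁ hy₂ hy₃
  -- pullers unswitched at `y₃ ≤ v`: their normal form is antitone, and the theorem wants unswitched at the right end `y₃`
  obtain ⟨e₁, he₁⟩ := Nat.exists_eq_add_of_lt h01
  obtain ⟨e₂, he₂⟩ := Nat.exists_eq_add_of_lt h12
  have hd := fin3_support_eq_gaps d e₁ e₂ he₁ he₂
  have hev : ∀ j x, (∑ l, C (a j l) * X ^ (d l) : ℝ[X]).eval x
        = x ^ (d 0) * (a j 0 + a j 1 * x ^ (e₁ + 1) + a j 2 * x ^ (e₁ + e₂ + 2)) := by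
    intro j x
    have h := (eval_trinomial_three (d 0) (e₁ + 1) (e₁ + e₂ + 2) (a j) x).1
    rw [hd] at h; rw [h]; ring
  have hun3 : ∀ j, j ≠ j₀ → 0 < (∑ l, C (a j l) * X ^ (d l) : ℝ[X]).eval y₃ := by
    intro j hj
    obtain ⟨_, h1, h2, _⟩ := hpul j hj
    have h := hun j hj
    rw [hev] at h ⊢
    have hv0 : 0 < v := hu.trans (hy₃.2.1.trans hy₃.2.2)
    have hy0 : 0 < y₃ := hu.trans hy₃.2.1
    have h3 : 0 < a j 0 + a j 1 * v ^ (e₁ + 1) + a j 2 * v ^ (e₁ + e₂ + 2) := (mul_pos_iff_of_pos_left (pow_pos hv0 _)).1 h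
    have hm1 : a j 1 * v ^ (e₁ + 1) ≤ a j 1 * y₃ ^ (e₁ + 1) :=
      mul_le_mul_of_nonpos_left (pow_le_pow_left₀ hy0.le hy₃.2.2.le _) h1
    have hm2 : a j 2 * v ^ (e₁ + e₂ + 2) ≤ a j 2 * y₃ ^ (e₁ + e₂ + 2) :=
      mul_le_mul_of_nonpos_left (pow_le_pow_left₀ hy0.le hy₃.2.2.le _) h2
    exact mul_pos (pow_pos hy0 _) (by linarith)
  refine oneRiser_trinomialCloud_wronskian_no_three_zeros d h01 h12 a j₀ hr0 hr1 hr2 hpul (hu.trans hy₁.2.1) h12' h23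
    (fun x hx => hsw x ⟨hy₁.2.1.le.trans hx.1, hx.2.trans hy₃.2.2.le⟩) hun3 ?_
  intro x hx
  simp only [Set.mem_insert_iff, Set.mem_singleton_iff] at hx
  rcases hx with h | h | h <;> subst h
  · exact hy₁.1
  · exact hy₂.1
  · exact hy₃.1

/-- ★★ **Hence AT MOST THREE zeros of `eulerNumerator d a l₀` on the window, for EVERY coupling `l₀`** (✓ `eulerNumerator_roots_Icc_le_wronskian_roots_add_one`).
[this file's theorem] -/
theorem oneRiser_trinomialCloud_eulerNumerator_roots_le_three {m : ℕ} (d : Fin 3 → ℕ) (h01 : d 0 < d 1) (h12 : d 1 < d 2)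
    (a : Fin m → Fin 3 → ℝ) (j₀ : Fin m) (hr0 : 0 ≤ a j₀ 0) (hr1 : a j₀ 1 < 0) (hr2 : a j₀ 2 < 0)
    (hpul : ∀ j, j ≠ j₀ → 0 < a j 0 ∧ a j 1 ≤ 0 ∧ a j 2 ≤ 0 ∧ a j 1 + a j 2 < 0)
    (l₀ : Fin 3) {u v : ℝ} (hu : 0 < u)
    (hsw : ∀ x ∈ Set.Icc u v, (∑ l, C (a j₀ l) * X ^ (d l) : ℝ[X]).eval x < 0)
    (hun : ∀ j, j ≠ j₀ → 0 < (∑ l, C (a j l) * X ^ (d l) : ℝ[X]).eval v) :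
    ((∑ j, (∑ l, C (a j l * ((d l : ℝ) - d l₀)) * X ^ (d l)) * ∏ i ∈ Finset.univ.erase j, (∑ l, C (a i l) * X ^ (d l))
        : ℝ[X]).roots.toFinset.filter (fun t => u ≤ t ∧ t ≤ v)).card ≤ 3 := by
  classical
  rcases lt_or_ge v u with hvu | huv
  · -- empty window
    have : ((∑ j, (∑ l, C (a j l * ((d l : ℝ) - d l₀)) * X ^ (d l)) * ∏ i ∈ Finset.univ.erase j, (∑ l, C (a i l) * X ^ (d l))
        : ℝ[X]).roots.toFinset.filter (fun t => u ≤ t ∧ t ≤ v)) = ∅ :=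
      Finset.filter_eq_empty_iff.2 fun t _ h => by linarith [h.1, h.2]
    rw [this]; simp
  -- no row vanishes on the window
  obtain ⟨e₁, he₁⟩ := Nat.exists_eq_add_of_lt h01
  obtain ⟨e₂, he₂⟩ := Nat.exists_eq_add_of_lt h12
  have hd := fin3_support_eq_gaps d e₁ e₂ he₁ he₂
  have hev : ∀ j x, (∑ l, C (a j l) * X ^ (d l) : ℝ[X]).eval x
        = x ^ (d 0) * (a j 0 + a j 1 * x ^ (e₁ + 1) + a j 2 * x ^ (e₁ + e₂ + 2)) := by
    intro j x
    have h := (eval_trinomial_three (d 0) (e₁ + 1) (e₁ + e₂ + 2) (a j) x).1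
    rw [hd] at h; rw [h]; ring
  have hP : ∀ t ∈ Set.Icc u v, (∏ j, (∑ l, C (a j l) * X ^ (d l) : ℝ[X])).eval t ≠ 0 := by
    intro t ht
    rw [eval_prod]
    refine Finset.prod_ne_zero_iff.2 fun j _ => ?_
    by_cases hj : j = j₀
    · subst hj; exact (hsw t ht).ne
    · obtain ⟨_, h1, h2, _⟩ := hpul j hj
      have h := hun j hj
      rw [hev] at h ⊢
      have hv0 : 0 < v := hu.trans_le huv
      have ht0 : 0 < t := hu.trans_le ht.1
      have h3 : 0 < a j 0 + a j 1 * v ^ (e₁ + 1) + a j 2 * v ^ (e₁ + e₂ + 2) := (mul_pos_iff_of_pos_left (pow_pos hv0 _)).1 h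
      have hm1 : a j 1 * v ^ (e₁ + 1) ≤ a j 1 * t ^ (e₁ + 1) :=
        mul_le_mul_of_nonpos_left (pow_le_pow_left₀ ht0.le ht.2 _) h1
      have hm2 : a j 2 * v ^ (e₁ + e₂ + 2) ≤ a j 2 * t ^ (e₁ + e₂ + 2) :=
        mul_le_mul_of_nonpos_left (pow_le_pow_left₀ ht0.le ht.2 _) h2
      exact mul_ne_zero (pow_ne_zero _ ht0.ne') (by linarith)
  have h1 := eulerNumerator_roots_Icc_le_wronskian_roots_add_one d a l₀ hu hP
  have h2 := oneRiser_trinomialCloud_wronskian_roots_le_two d h01 h12 a j₀ hr0 hr1 hr2 hpul hu hsw hun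
  omega

end ProductPlusOne

end Summit.ValiantsHypothesis.ValiantsHypothesis.Theorems.LacunarySymmetroidMatrixDescartes
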